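import Mathlib
import Summits.Ventures.PercRepro2.HMFRootEdgeIff
import Summits.Ventures.PercRepro2.HMFOEdge

/-!
# What closes (HMF) across an edge at `a₃`: the chord condition on the cofactor (blind cell
PercRepro2, night-1 g17; NIGHT1-G17.md §4)

Across an edge `f` at `a₃` joining it to a root or to `o`, `HMFc = (1 − p f) · Φ` with the explicit
cofactor `Φ` (`RootEdge.HMFc_eq_factor`, `OEdge.HMFc_eq_factor_o`); at `p f = 0` the cofactor is the
mean field of the instance WITHOUT the edge, at `p f = 1` it is the first-order coefficient at the
coincidence.  If the cofactor lies above its chord —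
`(1 − p f) · Φ(p[f ↦ 0]) + p f · Φ(p[f ↦ 1]) ≤ Φ(p)` — then (HMF) at `p` follows from (HMF) at the
instance without the edge and the sign of the first-order coefficient:

* **`HMF_of_root_edge_of_chord`**: for `f = {a₃, a₁}`, the chord condition and (HMF) at `p[f ↦ 0]`
  give (HMF) at `p` — the first-order coefficient is a theorem (`RootEdge.Phi_nonneg_of_sure`);
* **`HMF_of_o_edge_of_chord`**: for `f = {a₃, o}`, the chord condition, (HMF) at `p[f ↦ 0]` and
  `0 ≤ Φ_o(p[f ↦ 1])` (the first-order coefficient at `a₃ = o`, census-true, open) give (HMF) at `p`.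

The cofactors are quadratic in `p f`, so the chord condition is their concavity along the edge; it
holds on most but NOT all instances (NIGHT1-G17.md §4, §5) — these theorems state exactly what a
proof of the mixed class must supply.  Own code; standard axioms.
-/

namespace Summit.Ventures.PercRepro2

open UnionCluster CovForm

namespace EdgeChord

variable {V : Type*} {E : Type*} [Fintype E] [DecidableEq E] [Fintype V] [DecidableEq V]
  {R : Type*} [Field R] [LinearOrder R] [IsStrictOrderedRing R]

variable (p : E → R) (ends : E → Sym2 V) (o a₁ a₂ a₃ b : V) {f : E}

omit [LinearOrder R] [IsStrictOrderedRing R] in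
/-- At `p f = 0` the root-edge cofactor is the mean field of the instance without the edge. -/
lemma Phi_update_zero (hf : ends f = s(a₃, a₁)) :
    RootEdge.Phi (Function.update p f 0) ends o a₁ a₂ a₃ b f =
      HMFc (Function.update p f 0) ends o a₁ a₂ a₃ b := by
  rw [RootEdge.HMFc_eq_factor (Function.update p f 0) ends o b hf]
  simp

omit [LinearOrder R] [IsStrictOrderedRing R] in
/-- At `p f = 0` the `o`-edge cofactor is the mean field of the instance without the edge. -/
lemma PhiO_update_zero (hf : ends f = s(a₃, o)) :
    OEdge.PhiO (Function.update p f 0) ends o a₁ a₂ a₃ b f =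
      HMFc (Function.update p f 0) ends o a₁ a₂ a₃ b := by
  rw [OEdge.HMFc_eq_factor_o (Function.update p f 0) ends o b hf]
  simp

/-- **(HMF) across a root edge at `a₃` from the chord condition**: if the cofactor `Φ_f` lies above
its chord and (HMF) holds without the edge, (HMF) holds. -/
theorem HMF_of_root_edge_of_chord (hp : IsProbVec p) (hf : ends f = s(a₃, a₁))
    (hchord : (1 - p f) * RootEdge.Phi (Function.update p f 0) ends o a₁ a₂ a₃ b f +
      p f * RootEdge.Phi (Function.update p f 1) ends o a₁ a₂ a₃ b f ≤
        RootEdge.Phi p ends o a₁ a₂ a₃ b f)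
    (h0 : HMF (Function.update p f 0) ends o a₁ a₂ a₃ b) : HMF p ends o a₁ a₂ a₃ b := by
  unfold HMF
  rw [RootEdge.HMFc_eq_factor p ends o b hf]
  have h1 : 0 ≤ RootEdge.Phi (Function.update p f 1) ends o a₁ a₂ a₃ b f :=
    RootEdge.Phi_nonneg_of_sure (Function.update p f 1) ends o a₁ a₂ a₃ b
      (hp.update f zero_le_one le_rfl) hf (by simp)
  rw [Phi_update_zero p ends o a₁ a₂ a₃ b hf] at hchord
  unfold HMF at h0
  have hq0 := hp.nonneg f
  have hq1 := hp.le_one f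
  have hΦ : 0 ≤ RootEdge.Phi p ends o a₁ a₂ a₃ b f := by
    refine le_trans ?_ hchord
    exact add_nonneg (mul_nonneg (by linarith) h0) (mul_nonneg hq0 h1)
  exact mul_nonneg (by linarith) hΦ

/-- **(HMF) across the edge `{a₃, o}` from the chord condition and the first-order coefficient**:
if the cofactor `Φ_o` lies above its chord, (HMF) holds without the edge and `0 ≤ Φ_o(p[f ↦ 1])`,
then (HMF) holds. -/
theorem HMF_of_o_edge_of_chord (hp : IsProbVec p) (hf : ends f = s(a₃, o))
    (hchord : (1 - p f) * OEdge.PhiO (Function.update p f 0) ends o a₁ a₂ a₃ b f +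
      p f * OEdge.PhiO (Function.update p f 1) ends o a₁ a₂ a₃ b f ≤
        OEdge.PhiO p ends o a₁ a₂ a₃ b f)
    (h0 : HMF (Function.update p f 0) ends o a₁ a₂ a₃ b)
    (h1 : 0 ≤ OEdge.PhiO (Function.update p f 1) ends o a₁ a₂ a₃ b f) :
    HMF p ends o a₁ a₂ a₃ b := by
  unfold HMF
  rw [OEdge.HMFc_eq_factor_o p ends o b hf]
  rw [PhiO_update_zero p ends o a₁ a₂ a₃ b hf] at hchord
  unfold HMF at h0
  have hq0 := hp.nonneg f
  have hq1 := hp.le_one f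
  have hΦ : 0 ≤ OEdge.PhiO p ends o a₁ a₂ a₃ b f := by
    refine le_trans ?_ hchord
    exact add_nonneg (mul_nonneg (by linarith) h0) (mul_nonneg hq0 h1)
  exact mul_nonneg (by linarith) hΦ

end EdgeChord

end Summit.Ventures.PercRepro2
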